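import Summits.BirchSwinnertonDyer.Rank1Residual.X12.O11.RouteUPrimePsi
import Summits.BirchSwinnertonDyer.Rank1Residual.X12.O11.RouteUQuadraticTwin
import Summits.BirchSwinnertonDyer.Rank1Residual.X12.O11.RouteUBernoulliD11
import Summits.BirchSwinnertonDyer.Rank1Residual.X12.O11.RouteUDescentLocal
import Summits.BirchSwinnertonDyer.Rank1Residual.X12.O11.RouteUBernoulliCharChangeLevel
import Literature.NumberTheory.EllipticCurves.BuhlerGross1985.PiDescent
import Literature.NumberTheory.QuadraticFields.ImaginaryQuadraticPrescribedSplitting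
import HarnessLib

/-!
# ROUTE U, prime members `49a1^{(−q)}`: the DESCENT side (`7 ∤ #Ш(W)` from Buhler–Gross 1985 Ch. II
# BY NAME) and the TWIN side (`7 ∤ #Ш(W^{(−r)})` from Rubin 1983 Thm C BY NAME), for a variable prime `q`

bsd-cm cell (run/shared/lean/pub/bsd-cm/), ROUTE U (Theorem U: BSD(49a1^{(D)}, 7) ⇒ full BSD on `𝒞₇`),
seat `bsd-cm-ram`; planner ORDER «generic-q refactor» + «`RouteUSelmerPiDescentBG85`». Parameters: a
prime `q ≡ 3 (mod 4)`, `q ≠ 7` (`D = −q`) and a prime `r ≡ 3 (mod 4)` (Heegner field `ℚ(√−r)`, twin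
`49a1^{(qr)}`). Both Ш-inputs of THEOREM U for the prime members are obtained here from PUBLISHED
named facts plus the two Bernoulli-unit certificate hypotheses (`hcert₁`: `‖B_{1,ω⁴χ_{−q}}‖₇ = 1` at
level `7q`; `hcert₂`: `‖B_{1,ωχ_{−q}χ_{−r}}‖₇ = 1` at level `7qr`):

* §1 `norm_bernoulliOnePrim_mulTeichmuller_pow_four` + **`not_seven_dvd_shaOrder_of_buhlerGross`** —
  `7 ∤ #Ш(W)` for `W` any model of `49a1^{(−q)}` of rank `≥ 1`, from
  `BuhlerGross1985.firstDescent_seven_oddTwist_of_bernoulli` (clause (iii)) with `M = ℚ(√−q)` produced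
  inside and `χ_M = J(·|q)↑` (`RouteUQuadraticTwin`), the (8.3)(1) Bernoulli condition being `hcert₁`
  read on `θ₁ = χ_q↑·(ω⁴)↑ = ψ_q⁻¹` (`RouteUDescentLocal.thetaOnePrime_apply`, `RouteUPrimePsi`);
* §2 the Jacobi character `χ_q↑·χ_r↑` mod `qr` (values `J(·|qr)`, primitive, even) and
  **`not_seven_dvd_shaOrder_twin_prime`** — `7 ∤ #Ш(Wd)` for every model `Wd` of `W^{(−r)} ≅ 49a1^{(qr)}`
  from `Rubin1983.thmC_seven_quadraticField` over `M = ℚ(√(qr))`, its conditions `‖B_{1,ω}‖₇ = 1`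
  (`RouteUBernoulliD11.norm_bernoulliOnePrim_teichmuller_seven`) and `‖B_{1,χ_Mω}‖₇ = 1` (= `hcert₂` via
  `θ₂` of `RouteUPrimePsi`).

THEOREMS ONLY; no definitions, no new named facts; nothing booked.
References: [BuhlerGross1985] Ch. II §§7–9; [Rubin1983] Thm C; [KrizLi2019] §1.5, Thm 1.20;
[Cox2013] Lemma 1.14; [Washington1997] §5.1.
-/

noncomputable section

open scoped Classical
open NumberField WeierstrassCurve DirichletCharacter
open Literature.NumberTheory.EllipticCurves Literature.NumberTheory.EllipticCurves.Rank1Residual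
open Literature.NumberTheory.EllipticCurves.KrizLi2019 Literature.NumberTheory.LFunctions
open Literature.NumberTheory.EllipticCurves.Rubin1983 (mulTeichmuller thmC_seven_quadraticField)
open Literature.NumberTheory.QuadraticFields
open Literature.NumberTheory.EllipticCurves.BuhlerGross1985 (firstDescent_seven_oddTwist_of_bernoulli)

namespace Summit.BirchSwinnertonDyer.Rank1Residual.X12.O11.RouteU

/-! ## §1 `7 ∤ #Ш(W)` from Buhler–Gross 1985 Ch. II BY NAME -/

section ThetaOne

variable {q : ℕ} [hq : Fact q.Prime] (ω : DirichletCharacter ℚ_[7] 7) (χ : DirichletCharacter ℚ_[7] q)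

/-- **`‖B_{1,χ_Mω⁴}‖₇ = 1` in Buhler–Gross's shape from the `θ₁`-certificate**: for the Legendre
character `χ` mod `q` transported to any level `n` with `q ∣ n` (in the application `n = |d_M| = q`),
`mulTeichmuller (χ↑) (ω⁴)` lifts `θ₁ = χ↑·(ω⁴)↑ = ψ_q⁻¹` (primitive, `psiPrime_inv_isPrimitive`), whose
Bernoulli number is the certified `B_{1,θ₁}`. [cite: BuhlerGross1985, Ch. II Prop. (8.3)(1) (p. 17)]
[cite: KrizLi2019, §1.5 display (1) (p. 7)] -/
theorem norm_bernoulliOnePrim_mulTeichmuller_pow_four (hω : IsTeichmullerCharacter ω)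
    (hq7 : q ≠ 7) (hq2 : q ≠ 2) (hχ : ∀ a : ℕ, χ (a : ZMod q) = (legendreSym q (a : ℤ) : ℚ_[7]))
    (hcert₁ : ∀ θ : DirichletCharacter ℚ_[7] (7 * q),
        (∀ j : ZMod (7 * q), θ j = (legendreSym q (j.val : ℤ) : ℚ_[7]) * ω (j.val : ZMod 7) ^ 4) →
        ‖generalizedBernoulli 1 θ‖ = 1)
    {n : ℕ} [NeZero n] (h : q ∣ n) :
    ‖bernoulliOnePrim (mulTeichmuller (changeLevel h χ) (ω ^ 4))‖ = 1 := by
  have hqq : 7 * q ∣ n * 7 := by rw [mul_comm 7 q]; exact mul_dvd_mul_right h 7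
  have e : mulTeichmuller (changeLevel h χ) (ω ^ 4) =
      changeLevel hqq (changeLevel (dvd_mul_left q 7) χ * changeLevel (dvd_mul_right 7 q) (ω ^ 4)) := by
    rw [mulTeichmuller]
    simp only [map_mul, ← changeLevel_trans]
  have hθ : (changeLevel (dvd_mul_left q 7) χ * changeLevel (dvd_mul_right 7 q) (ω ^ 4) :
      DirichletCharacter ℚ_[7] (7 * q)) =
      (changeLevel (dvd_mul_left q 7) χ * changeLevel (dvd_mul_right 7 q) (ω ^ 2))⁻¹ :=
    MulChar.ext' fun j => by rw [thetaOnePrime_apply ω χ hχ, psiPrime_inv_apply ω χ hχ]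
  rw [e, bernoulliOnePrim_changeLevel_eq _
    (by rw [hθ]; exact psiPrime_inv_isPrimitive ω χ hq7 hq2 hω hχ) hqq]
  exact hcert₁ _ (thetaOnePrime_apply ω χ hχ)

/-- **`7 ∤ #Ш(W)` from Buhler–Gross 1985 Ch. II BY NAME** (the `√−7`-descent on the odd twists of
`A(7) = 49a1`, named fact `BuhlerGross1985.firstDescent_seven_oddTwist_of_bernoulli`, clause (iii)):
for `W` any model of `49a1^{(−q)}` (`q ≡ 3 (mod 4)` prime, `q ≠ 7`) of Mordell–Weil rank `≥ 1` with
`Ш(W)` finite, given the `θ₁`-certificate `‖B_{1,ω⁴χ_{−q}}‖₇ = 1` (= (8.3)(1)'s `B₁(ψ⁻¹) ≠ 0`).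
The field `M = ℚ(√−q)` is produced inside (`Quadratic.exists_numberField_discr_eq`, imaginary by
`Quadratic.isTotallyComplex_of_discr_neg`), its Kronecker character is `J(·|q)↑`
(`isKroneckerCharacterOf_changeLevel_jacobi`). This DISCHARGES the binder `hSel` (via `hSW`) of the
member theorems. [cite: BuhlerGross1985, Ch. II Prop. (7.2)(2), (8.3)(1) and Cor. (9.1) proof (pp. 16–18)] -/
theorem not_seven_dvd_shaOrder_of_buhlerGross
    (hBG : BuhlerGross1985.firstDescent_seven_oddTwist_of_bernoulli) (hq4 : q % 4 = 3) (hq7 : q ≠ 7)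
    (hcert₁ : ∀ (ω : DirichletCharacter ℚ_[7] 7), IsTeichmullerCharacter ω →
      ∀ θ : DirichletCharacter ℚ_[7] (7 * q),
        (∀ j : ZMod (7 * q), θ j = (legendreSym q (j.val : ℤ) : ℚ_[7]) * ω (j.val : ZMod 7) ^ 4) →
        ‖generalizedBernoulli 1 θ‖ = 1)
    (W : WeierstrassCurve ℚ) [W.IsElliptic]
    (hW : ∃ C : VariableChange ℚ, C • W = cm7.quadraticTwist ((-(q : ℤ) : ℤ) : ℚ))
    (hrk : 1 ≤ W.mordellWeilRank) [Finite W.sha] : ¬ 7 ∣ W.shaOrder := by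
  haveI : Fact (Nat.Prime 7) := ⟨by norm_num⟩
  have hq2 : q ≠ 2 := by rintro rfl; norm_num at hq4
  obtain ⟨ω, hω⟩ := exists_isTeichmullerCharacter (p := 7)
  obtain ⟨χ, hχ⟩ := exists_legendreCharacter q
  have hχJ : ∀ a : ℕ, χ (a : ZMod q) = (jacobiSym (a : ℤ) q : ℚ_[7]) := fun a => by
    rw [hχ, jacobiSym.legendreSym.to_jacobiSym]
  have hχp : χ.IsPrimitive := conductor_eq_of_prime_of_ne_one χ (legendreChar_ne_one hq2 χ hχ)
  obtain ⟨M, _, _, hM2, hdM⟩ := Quadratic.exists_numberField_discr_eq (isFundamental_neg_prime hq4)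
  have hnat : (NumberField.discr M).natAbs = q := by rw [hdM]; simp
  haveI : NeZero (NumberField.discr M).natAbs := ⟨by rw [hnat]; exact hq.out.ne_zero⟩
  have hMim : IsImaginaryQuadratic M :=
    ⟨hM2, Quadratic.isTotallyComplex_of_discr_neg hM2 (by rw [hdM]; have := hq.out.pos; omega)⟩
  have h7M : ¬ ((7 : ℤ) ∣ NumberField.discr M) := by
    rw [hdM, dvd_neg]
    intro h
    exact hq7 (((Nat.prime_dvd_prime_iff_eq (by norm_num) hq.out).mp (by exact_mod_cast h))).symm
  have hdiv : q ∣ (NumberField.discr M).natAbs := by rw [hnat]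
  have hεM : IsKroneckerCharacterOf M (changeLevel hdiv χ) :=
    isKroneckerCharacterOf_changeLevel_jacobi hM2 (Or.inr ⟨hdM, hq4⟩) χ hχp hχJ hdiv
  have hB : ¬ (‖bernoulliOnePrim (mulTeichmuller (changeLevel hdiv χ) (ω ^ 4))‖ ≤ (7 : ℝ)⁻¹) := by
    rw [norm_bernoulliOnePrim_mulTeichmuller_pow_four ω χ hω hq7 hq2 hχ (hcert₁ ω hω) hdiv]
    norm_num
  have hW' : ∃ C : VariableChange ℚ, C • W = cm7.quadraticTwist (NumberField.discr M : ℚ) := by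
    rw [hdM]; exact hW
  obtain ⟨-, -, hsha⟩ := hBG ω hω M hMim h7M (changeLevel hdiv χ) hεM hB W hW'
  intro h7
  obtain ⟨x, hx⟩ := exists_prime_addOrderOf_dvd_card' (G := W.sha) 7 h7
  have hx0 : x ≠ 0 := by
    intro h0; rw [h0, addOrderOf_zero] at hx; norm_num at hx
  have h7x' : (7 : ℕ) • x = 0 := by rw [← hx]; exact addOrderOf_nsmul_eq_zero x
  have h7x : (7 : ℕ) • (x : W.galH1) = 0 := by exact_mod_cast congrArg Subtype.val h7x'
  exact hx0 (Subtype.ext (hsha hrk x x.2 h7x))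

end ThetaOne

/-! ## §2 The Jacobi character mod `q·r` and the twin `49a1^{(qr)}` (Rubin Thm C BY NAME) -/

section Twin

variable {q r : ℕ} [hq : Fact q.Prime] [hr : Fact r.Prime]
  (χ : DirichletCharacter ℚ_[7] q) (κ : DirichletCharacter ℚ_[7] r)

/-- **Values of `χ_q↑ · χ_r↑` mod `qr`: `J(a | qr)`** for Legendre-valued `χ` mod `q`, `κ` mod `r`,
`q ≠ r`. [cite: Cox2013, §1.C Lemma 1.14] -/
theorem jacobiCharMul_apply
    (hχ : ∀ a : ℕ, χ (a : ZMod q) = (legendreSym q (a : ℤ) : ℚ_[7]))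
    (hκ : ∀ a : ℕ, κ (a : ZMod r) = (legendreSym r (a : ℤ) : ℚ_[7])) (a : ℕ) :
    (changeLevel (dvd_mul_right q r) χ * changeLevel (dvd_mul_left r q) κ) (a : ZMod (q * r))
      = (jacobiSym a (q * r) : ℚ_[7]) := by
  have hJ : jacobiSym a (q * r) = legendreSym q a * legendreSym r a := by
    rw [jacobiSym.mul_right, ← jacobiSym.legendreSym.to_jacobiSym, ← jacobiSym.legendreSym.to_jacobiSym]
  have ha : ((a : ℤ) : ZMod (q * r)) = (a : ZMod (q * r)) := Int.cast_natCast a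
  by_cases hu : IsCoprime (a : ℤ) ((q * r : ℕ) : ℤ)
  · rw [← ha, MulChar.mul_apply, changeLevel_eq_cast_of_dvd' _ _ hu,
      changeLevel_eq_cast_of_dvd' _ _ hu, Int.cast_natCast, Int.cast_natCast, hχ, hκ, hJ,
      Int.cast_mul]
  · have hnu : ¬ IsUnit (a : ZMod (q * r)) := by
      rw [← ha, ZMod.coe_int_isUnit_iff_isCoprime]; exact fun h => hu (isCoprime_comm.mp h)
    rw [MulChar.map_nonunit _ hnu]
    have hg : (a : ℤ).gcd (q * r) ≠ 1 := fun h1 => hu (Int.isCoprime_iff_gcd_eq_one.mpr h1)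
    rw [jacobiSym.eq_zero_iff.mpr ⟨NeZero.ne _, hg⟩, Int.cast_zero]

/-- `χ_q↑ · χ_r↑` mod `qr` is **primitive** (`q ≠ r` odd primes). [folklore] -/
theorem jacobiCharMul_isPrimitive (hqr : q ≠ r) (hq2 : q ≠ 2) (hr2 : r ≠ 2)
    (hχ : ∀ a : ℕ, χ (a : ZMod q) = (legendreSym q (a : ℤ) : ℚ_[7]))
    (hκ : ∀ a : ℕ, κ (a : ZMod r) = (legendreSym r (a : ℤ) : ℚ_[7])) :
    (changeLevel (dvd_mul_right q r) χ * changeLevel (dvd_mul_left r q) κ).IsPrimitive := by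
  have hcq := conductor_eq_of_prime_of_ne_one χ (legendreChar_ne_one hq2 χ hχ)
  have hcr := conductor_eq_of_prime_of_ne_one κ (legendreChar_ne_one hr2 κ hκ)
  have hcop : q.Coprime r := (Nat.coprime_primes hq.out hr.out).mpr hqr
  change DirichletCharacter.conductor _ = q * r
  rw [conductor_changeLevel_mul_changeLevel _ _ χ κ (by rw [hcq, hcr]; exact hcop), hcq, hcr]

/-- `χ_q↑ · χ_r↑` mod `qr` is **even** when `qr ≡ 1 (mod 4)` (`J(−1 | qr) = χ₄(qr) = 1`). [folklore] -/
theorem jacobiCharMul_even (hqr4 : (q * r) % 4 = 1)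
    (hχ : ∀ a : ℕ, χ (a : ZMod q) = (legendreSym q (a : ℤ) : ℚ_[7]))
    (hκ : ∀ a : ℕ, κ (a : ZMod r) = (legendreSym r (a : ℤ) : ℚ_[7])) :
    (changeLevel (dvd_mul_right q r) χ * changeLevel (dvd_mul_left r q) κ).Even := by
  have h1 : 1 ≤ q * r := Nat.one_le_iff_ne_zero.mpr (NeZero.ne _)
  have hneg : (-1 : ZMod (q * r)) = ((q * r - 1 : ℕ) : ZMod (q * r)) := by
    rw [Nat.cast_sub h1, Nat.cast_one, ZMod.natCast_self, zero_sub]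
  change _ = (1 : ℚ_[7])
  rw [hneg, jacobiCharMul_apply χ κ hχ hκ]
  have hodd : Odd (q * r) := Nat.odd_iff.mpr (by omega)
  have e : ((q * r - 1 : ℕ) : ℤ) = -1 + (q * r : ℕ) * 1 := by push_cast [Nat.cast_sub h1]; ring
  rw [e, jacobiSym.mod_left, Int.add_mul_emod_self_left, ← jacobiSym.mod_left, jacobiSym.at_neg_one hodd,
    ZMod.χ₄_nat_one_mod_four hqr4]
  simp

/-- **`‖B_{1,χ_{qr}ω}‖₇ = 1` from a `θ₂`-certificate**: with `κ'` mod `r` (Jacobi values, primitive)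
and `χ` mod `q` (Legendre values), `mulTeichmuller (χ↑·κ'↑) ω` IS the `θ₂`-character of
`RouteUPrimePsi` lifted along `7·q·r ∣ q·r·7`, so its primitive Bernoulli number is the certified
`B_{1,θ₂}`. [cite: Rubin1983, §0 Thm. C (p. 341)] [cite: KrizLi2019, §1.5 display (1) (p. 7)] -/
theorem norm_bernoulliOnePrim_mulTeichmuller_prime (ω : DirichletCharacter ℚ_[7] 7)
    (hω : IsTeichmullerCharacter ω) (hq7 : q ≠ 7) (hq2 : q ≠ 2) (hr7 : r.Coprime 7) (hrq : r.Coprime q)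
    (κ' : DirichletCharacter ℚ_[7] r) (hκ'p : κ'.IsPrimitive)
    (hχ : ∀ a : ℕ, χ (a : ZMod q) = (legendreSym q (a : ℤ) : ℚ_[7]))
    (hcert₂ : ‖generalizedBernoulli 1
      (changeLevel ((dvd_mul_left q 7).trans (dvd_mul_right (7 * q) r)) χ *
        changeLevel (dvd_mul_left r (7 * q)) κ' *
        changeLevel ((dvd_mul_right 7 q).trans (dvd_mul_right (7 * q) r)) ω :
        DirichletCharacter ℚ_[7] (7 * q * r))‖ = 1) :
    ‖bernoulliOnePrim (mulTeichmuller
      (changeLevel (dvd_mul_right q r) χ * changeLevel (dvd_mul_left r q) κ') ω)‖ = 1 := by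
  have hdiv : 7 * q * r ∣ q * r * 7 := ⟨1, by ring⟩
  have hΘ : mulTeichmuller (changeLevel (dvd_mul_right q r) χ * changeLevel (dvd_mul_left r q) κ') ω =
      changeLevel hdiv
        (changeLevel ((dvd_mul_left q 7).trans (dvd_mul_right (7 * q) r)) χ *
          changeLevel (dvd_mul_left r (7 * q)) κ' *
          changeLevel ((dvd_mul_right 7 q).trans (dvd_mul_right (7 * q) r)) ω) := by
    rw [mulTeichmuller]
    simp only [map_mul, ← changeLevel_trans]
  rw [hΘ, bernoulliOnePrim_changeLevel_eq _ (thetaTwo_isPrimitive ω χ κ' hq7 hq2 hr7 hrq hω hχ hκ'p) hdiv]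
  exact hcert₂

/-- **The twin side BY NAME for a prime member**: for every model `W` of `49a1^{(−q)}` and every
elliptic model `Wd` of `W^{(−r)}` (`≅ 49a1^{(qr)}`) with `Ш(Wd)` finite: `7 ∤ #Ш(Wd)` — from
Rubin 1983 Thm C at `p = 7` over `M = ℚ(√(qr))` (named fact `thmC_seven_quadraticField`), its two
Bernoulli conditions discharged by `‖B_{1,ω}‖₇ = 1` (kernel) and the `θ₂`-certificate hypothesis.
[cite: Rubin1983, §0 Thm. C (p. 341)] [cite: BuhlerGross1985, Prop. (8.4)(1) and Cor. (9.1) (p. 18)] -/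
theorem not_seven_dvd_shaOrder_twin_prime (h : thmC_seven_quadraticField)
    (hqr : q ≠ r) (hq4 : q % 4 = 3) (hr4 : r % 4 = 3) (hq7 : q ≠ 7) (hr7 : r ≠ 7)
    (hcert₂ : ∀ (ω : DirichletCharacter ℚ_[7] 7), IsTeichmullerCharacter ω →
      ∀ θ : DirichletCharacter ℚ_[7] (7 * q * r),
        (∀ j : ZMod (7 * q * r), θ j =
          ((legendreSym q (j.val : ℤ) * jacobiSym (j.val : ℤ) r : ℤ) : ℚ_[7]) * ω (j.val : ZMod 7) ^ 1) →
        ‖generalizedBernoulli 1 θ‖ = 1)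
    (W : WeierstrassCurve ℚ)
    (hW : ∃ C : VariableChange ℚ, C • W = cm7.quadraticTwist ((-(q : ℤ) : ℤ) : ℚ))
    (Wd : WeierstrassCurve ℚ) [Wd.IsElliptic] (Cd : VariableChange ℚ)
    (hWd : Cd • W.quadraticTwist ((-(r : ℤ) : ℤ) : ℚ) = Wd) [Finite Wd.sha] :
    ¬ 7 ∣ Wd.shaOrder := by
  have hq2 : q ≠ 2 := by rintro rfl; norm_num at hq4
  have hr2 : r ≠ 2 := by rintro rfl; norm_num at hr4
  have hr7' : r.Coprime 7 := (Nat.coprime_primes hr.out (by norm_num)).mpr hr7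
  have hrq' : r.Coprime q := (Nat.coprime_primes hr.out hq.out).mpr (Ne.symm hqr)
  obtain ⟨ω, hω⟩ := exists_isTeichmullerCharacter (p := 7)
  obtain ⟨M, _, _, hM2, hdM⟩ := Quadratic.exists_numberField_discr_eq (isFundamental_mul_primes hqr hq4 hr4)
  have hnat : (NumberField.discr M).natAbs = q * r := by rw [hdM]; rfl
  haveI : NeZero (NumberField.discr M).natAbs := ⟨by rw [hnat]; exact NeZero.ne _⟩
  obtain ⟨χ, hχ⟩ := exists_legendreCharacter q
  obtain ⟨κ', hκ'⟩ := exists_legendreCharacter r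
  have hκ'J : ∀ a : ℕ, κ' (a : ZMod r) = (jacobiSym (a : ℤ) r : ℚ_[7]) := fun a => by
    rw [hκ', jacobiSym.legendreSym.to_jacobiSym]
  have hκ'p : κ'.IsPrimitive := conductor_eq_of_prime_of_ne_one κ' (legendreChar_ne_one hr2 κ' hκ')
  -- the Kronecker character of `M = ℚ(√(qr))`
  set κM := changeLevel (dvd_mul_right q r) χ * changeLevel (dvd_mul_left r q) κ' with hκM
  have hdiv : q * r ∣ (NumberField.discr M).natAbs := by rw [hnat]
  have hqr4 : (q * r) % 4 = 1 := by rw [Nat.mul_mod, hq4, hr4]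
  have hK : IsKroneckerCharacterOf M (changeLevel hdiv κM) :=
    isKroneckerCharacterOf_changeLevel_jacobi hM2 (Or.inl ⟨hdM, hqr4⟩) κM
      (jacobiCharMul_isPrimitive χ κ' hqr hq2 hr2 hχ hκ') (jacobiCharMul_apply χ κ' hχ hκ') hdiv
  have heven : (changeLevel hdiv κM).Even := by
    change changeLevel hdiv κM (-1) = 1
    have hc : IsCoprime (-1 : ℤ) (((NumberField.discr M).natAbs : ℕ) : ℤ) := isCoprime_one_left.neg_left
    have hv := changeLevel_eq_cast_of_dvd' κM hdiv hc
    push_cast at hv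
    rw [hv]
    exact jacobiCharMul_even χ κ' hqr4 hχ hκ'
  have h7 : ¬ ((7 : ℤ) ∣ NumberField.discr M) := by
    rw [hdM]
    intro hdvd
    have : (7 : ℕ) ∣ q * r := by exact_mod_cast hdvd
    rcases (Nat.Prime.dvd_mul (by norm_num)).mp this with h | h
    · exact hq7 (((Nat.prime_dvd_prime_iff_eq (by norm_num) hq.out).mp h).symm)
    · exact hr7 (((Nat.prime_dvd_prime_iff_eq (by norm_num) hr.out).mp h).symm)
  have hB₁ := not_norm_mul_le_inv_of_norm_eq_one (p := 7)
    (norm_bernoulliOnePrim_teichmuller_seven ω hω) (norm_bernoulliOnePrim_teichmuller_seven ω hω)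
  -- `B_{1, χ_M ω}`: transport to level `q·r·7` and use the certificate
  have hu2 : ‖bernoulliOnePrim (mulTeichmuller (changeLevel hdiv κM) ω)‖ = 1 := by
    have e : mulTeichmuller (changeLevel hdiv κM) ω =
        changeLevel (mul_dvd_mul_right hdiv 7) (mulTeichmuller κM ω) := by
      rw [mulTeichmuller, mulTeichmuller]
      simp only [map_mul, ← changeLevel_trans]
    rw [e, bernoulliOnePrim_changeLevel]
    exact norm_bernoulliOnePrim_mulTeichmuller_prime χ ω hω hq7 hq2 hr7' hrq' κ' hκ'p hχ
      (hcert₂ ω hω _ (thetaTwo_apply ω χ κ' hχ hκ'J))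
  have hB₂ := not_norm_mul_le_inv_of_norm_eq_one (p := 7) hu2 hu2
  have hWd' : ∃ C' : VariableChange ℚ, C' • cm7.quadraticTwist (NumberField.discr M : ℚ) = Wd := by
    have e : ((NumberField.discr M : ℤ) : ℚ) = ((-(q : ℤ) : ℤ) : ℚ) * ((-(r : ℤ) : ℤ) : ℚ) := by
      rw [hdM]; push_cast; ring
    rw [e]
    exact exists_variableChange_cm7_twist_twist W hW Wd Cd hWd
  exact_mod_cast Rubin1983.not_dvd_shaOrder_twist_of_bernoulli h ω hω M hM2 h7 (changeLevel hdiv κM) hK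
    (by exact_mod_cast hB₁) heven (by exact_mod_cast hB₂) Wd hWd'

end Twin

end Summit.BirchSwinnertonDyer.Rank1Residual.X12.O11.RouteU

end
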